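import Mathlib
import HarnessLib

/-!
# Helper `helper_avr_eq_sublevelLimit` of line `Sketch` (crux `EntropyRung.ConicalGap`, stmt-SmoothPoincare4-16589)

Pure measure theory (Wang–Wang 2023, arXiv:2308.06560, (2.6)): the regularised asymptotic volume
ratio `a := lim_{T → ∞} (16π²T²)⁻¹ ∫ e^{-f/T} dμ` coincides with the classical sublevel asymptotic
volume ratio `A := lim_{t → ∞} μ{f < t} / (8π²t²)` whenever the latter exists.

Setting: a measure `μ` on a measurable space `X`, a measurable `f ≥ 0` with `e^{-f/T}` integrable for
every `T > 0`.  Write `V t := (μ {f < t}).toReal`; by Markov `μ {f < t} ≤ e^{t} ∫ e^{-f} dμ < ∞`, so `V`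
is the true (finite) volume, it is monotone, and `μ` is σ-finite.

* Layer cake (Tonelli on `{(x, t) | g x < t}`): for a measurable `g ≥ 0` with `e^{-g}` integrable,
  `∫ e^{-g} dμ = ∫_{t > 0} e^{-t} μ{g < t} dt` (`sublevelLimit_integral_exp_neg`); applied to
  `g = f / T` this is `∫ e^{-f/T} dμ = ∫_{s > 0} e^{-s} V (T s) ds` — the substitution `t = T s` is
  absorbed into the choice of `g`.
* Abelian limit: `V (T s) / (16π²T²) → e^{-s} s² A / 2`-weighted pointwise, dominated for `T ≥ 1` by
  `e^{-s} (C₀ + C₁ s²)` (from `V t ≤ C₀ + C₁ · 8π² t²`, a consequence of the hypothesis and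
  monotonicity), so by dominated convergence the limit is `(A/2) ∫_{s>0} e^{-s} s² ds = (A/2) Γ(3) = A`.

Everything here is proved from Mathlib; no definition and no named fact is introduced.

## References

* Y. Wang, G. Wang (Wang–Wang 2023), arXiv:2308.06560, §2, (2.6).
-/

noncomputable section

-- `Summit.SmoothPoincare4.SmoothPoincare4.…` (summit = problem) trips `dupNamespace` on every decl.
set_option linter.dupNamespace false

open scoped ENNReal NNReal Topology
open MeasureTheory Set Filter

namespace Summit.SmoothPoincare4.SmoothPoincare4.Theorems.ConicalGapSketch

section LayerCake

variable {X : Type*} [MeasurableSpace X] {μ : Measure X} {g : X → ℝ}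

/-- Markov: if `e^{-g}` is `μ`-integrable then every strict sublevel set `{g < t}` has finite
measure (`{g < t} ⊆ {e^{-t} ≤ e^{-g}}`). -/
theorem sublevelLimit_measure_lt_top (hg : Integrable (fun x ↦ Real.exp (-g x)) μ) (t : ℝ) :
    μ {x | g x < t} < ∞ :=
  lt_of_le_of_lt (measure_mono fun x (hx : g x < t) ↦
    show Real.exp (-t) ≤ Real.exp (-g x) from Real.exp_le_exp.2 (neg_le_neg hx.le))
    (hg.measure_ge_lt_top (Real.exp_pos (-t)))

/-- Hence `μ` is σ-finite: `X = ⋃ₙ {g < n}`. -/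
theorem sublevelLimit_sigmaFinite (hg : Integrable (fun x ↦ Real.exp (-g x)) μ) :
    SigmaFinite μ := by
  refine Measure.sigmaFinite_of_countable (S := Set.range fun n : ℕ ↦ {x | g x < n})
    (Set.countable_range _) ?_ ?_
  · rintro _ ⟨n, rfl⟩
    exact sublevelLimit_measure_lt_top hg n
  · rw [Set.sUnion_range, Set.eq_univ_iff_forall]
    intro x
    obtain ⟨n, hn⟩ := exists_nat_gt (g x)
    exact Set.mem_iUnion.2 ⟨n, hn⟩

/-- `∫_{t > a} e^{-t} dt = e^{-a}` as a Lebesgue integral over `(0, ∞)` of an indicator, `a ≥ 0`. -/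
theorem sublevelLimit_lintegral_Ioi_indicator {a : ℝ} (ha : 0 ≤ a) :
    ∫⁻ t in Ioi (0 : ℝ), (Ioi a).indicator (fun t ↦ ENNReal.ofReal (Real.exp (-t))) t =
      ENNReal.ofReal (Real.exp (-a)) := by
  rw [setLIntegral_indicator measurableSet_Ioi, Ioi_inter_Ioi, sup_of_le_left ha,
    ← ofReal_integral_eq_lintegral_ofReal (integrableOn_exp_neg_Ioi a)
      (ae_of_all _ fun t ↦ (Real.exp_pos _).le), integral_exp_neg_Ioi]

/-- Layer cake for `e^{-g}`, Lebesgue form: for a measurable `g ≥ 0` with `e^{-g}` integrable,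
`∫⁻ e^{-g} dμ = ∫⁻_{t > 0} μ{g < t} · e^{-t} dt` (Tonelli on `{(x, t) | g x < t}`). -/
theorem sublevelLimit_lintegral_exp_neg (hg : Measurable g) (hg0 : ∀ x, 0 ≤ g x)
    (hgi : Integrable (fun x ↦ Real.exp (-g x)) μ) :
    ∫⁻ x, ENNReal.ofReal (Real.exp (-g x)) ∂μ =
      ∫⁻ t in Ioi (0 : ℝ), μ {x | g x < t} * ENNReal.ofReal (Real.exp (-t)) := by
  haveI := sublevelLimit_sigmaFinite hgi
  set S : Set (X × ℝ) := {p | g p.1 < p.2} with hS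
  have hSm : MeasurableSet S := measurableSet_lt (hg.comp measurable_fst) measurable_snd
  have hG : Measurable fun p : X × ℝ ↦ ENNReal.ofReal (Real.exp (-p.2)) := by fun_prop
  have h1 : ∀ x, ENNReal.ofReal (Real.exp (-g x)) =
      ∫⁻ t in Ioi (0 : ℝ), S.indicator (fun p ↦ ENNReal.ofReal (Real.exp (-p.2))) (x, t) := by
    intro x
    rw [← sublevelLimit_lintegral_Ioi_indicator (hg0 x)]
    refine lintegral_congr fun t ↦ ?_
    simp [hS, Set.indicator_apply]
  have h2 : ∀ t, ∫⁻ x, S.indicator (fun p ↦ ENNReal.ofReal (Real.exp (-p.2))) (x, t) ∂μ =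
      μ {x | g x < t} * ENNReal.ofReal (Real.exp (-t)) := by
    intro t
    have : (fun x ↦ S.indicator (fun p ↦ ENNReal.ofReal (Real.exp (-p.2))) (x, t)) =
        {x | g x < t}.indicator fun _ ↦ ENNReal.ofReal (Real.exp (-t)) := by
      funext x
      simp [hS, Set.indicator_apply]
    rw [this, lintegral_indicator_const (measurableSet_lt hg measurable_const), mul_comm]
  have hF : AEMeasurable
      (Function.uncurry fun x t ↦ S.indicator (fun p ↦ ENNReal.ofReal (Real.exp (-p.2))) (x, t))
      (μ.prod (volume.restrict (Ioi (0 : ℝ)))) := by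
    have : (Function.uncurry fun x t ↦
        S.indicator (fun p : X × ℝ ↦ ENNReal.ofReal (Real.exp (-p.2))) (x, t)) =
        S.indicator (fun p ↦ ENNReal.ofReal (Real.exp (-p.2))) := by
      funext p
      rfl
    rw [this]
    exact (hG.indicator hSm).aemeasurable
  calc ∫⁻ x, ENNReal.ofReal (Real.exp (-g x)) ∂μ
      = ∫⁻ x, (∫⁻ t in Ioi (0 : ℝ),
          S.indicator (fun p ↦ ENNReal.ofReal (Real.exp (-p.2))) (x, t)) ∂μ := lintegral_congr h1
    _ = ∫⁻ t in Ioi (0 : ℝ), ∫⁻ x,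
          S.indicator (fun p ↦ ENNReal.ofReal (Real.exp (-p.2))) (x, t) ∂μ :=
        lintegral_lintegral_swap hF
    _ = ∫⁻ t in Ioi (0 : ℝ), μ {x | g x < t} * ENNReal.ofReal (Real.exp (-t)) :=
        lintegral_congr h2

/-- Layer cake for `e^{-g}`, Bochner form: for a measurable `g ≥ 0` with `e^{-g}` integrable,
`∫ e^{-g} dμ = ∫_{t > 0} e^{-t} (μ{g < t}).toReal dt`. -/
theorem sublevelLimit_integral_exp_neg (hg : Measurable g) (hg0 : ∀ x, 0 ≤ g x)
    (hgi : Integrable (fun x ↦ Real.exp (-g x)) μ) :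
    ∫ x, Real.exp (-g x) ∂μ = ∫ t in Ioi (0 : ℝ), Real.exp (-t) * (μ {x | g x < t}).toReal := by
  have hfin := sublevelLimit_measure_lt_top hgi
  have hmono : Monotone fun t : ℝ ↦ (μ {x | g x < t}).toReal := fun s t hst ↦
    ENNReal.toReal_mono (hfin t).ne (measure_mono fun x (hx : g x < s) ↦ hx.trans_le hst)
  have hVm : Measurable fun t : ℝ ↦ (μ {x | g x < t}).toReal := hmono.measurable
  have hm : Measurable fun t : ℝ ↦ Real.exp (-t) * (μ {x | g x < t}).toReal :=
    (Real.continuous_exp.measurable.comp measurable_neg).mul hVm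
  rw [integral_eq_lintegral_of_nonneg_ae (ae_of_all _ fun x ↦ (Real.exp_pos _).le)
      hgi.aestronglyMeasurable,
    integral_eq_lintegral_of_nonneg_ae (ae_of_all _ fun t ↦ by positivity) hm.aestronglyMeasurable,
    sublevelLimit_lintegral_exp_neg hg hg0 hgi]
  congr 1
  refine setLIntegral_congr_fun measurableSet_Ioi fun t _ ↦ ?_
  rw [ENNReal.ofReal_mul (Real.exp_pos _).le, ENNReal.ofReal_toReal (hfin t).ne, mul_comm]

end LayerCake

/-- `∫_{s > 0} e^{-s} s² ds = Γ(3) = 2`. -/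
theorem sublevelLimit_integral_exp_neg_mul_sq :
    ∫ s in Ioi (0 : ℝ), Real.exp (-s) * s ^ 2 = 2 := by
  have h3 : Real.Gamma 3 = 2 := by
    rw [show (3 : ℝ) = 2 + 1 by norm_num, Real.Gamma_add_one two_ne_zero,
      show (2 : ℝ) = 1 + 1 by norm_num, Real.Gamma_add_one one_ne_zero, Real.Gamma_one]
    norm_num
  calc ∫ s in Ioi (0 : ℝ), Real.exp (-s) * s ^ 2
      = ∫ s in Ioi (0 : ℝ), Real.exp (-s) * s ^ ((3 : ℝ) - 1) :=
        setIntegral_congr_fun measurableSet_Ioi fun s _ ↦ by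
          simp only [show (3 : ℝ) - 1 = 2 by norm_num, Real.rpow_two]
    _ = Real.Gamma 3 := (Real.Gamma_eq_integral (by norm_num)).symm
    _ = 2 := h3

/-- **Wang–Wang 2023 (2.6), abstract form.** For a measure `μ` and a measurable `f ≥ 0` with
`e^{-f/T}` integrable for all `T > 0`: if `μ{f < t} / (8π²t²) → A` as `t → ∞`, then
`(16π²T²)⁻¹ ∫ e^{-f/T} dμ → A` as `T → ∞`. -/
theorem helper_avr_eq_sublevelLimit : ∀ (X : Type) [MeasurableSpace X] (μ : MeasureTheory.Measure X) (f : X → ℝ), Measurable f → (∀ x, 0 ≤ f x) → (∀ T : ℝ, 0 < T → MeasureTheory.Integrable (fun x ↦ Real.exp (-f x / T)) μ) → ∀ A : ℝ, Filter.Tendsto (fun t : ℝ ↦ (μ {x | f x < t}).toReal / (8 * Real.pi ^ 2 * t ^ 2)) Filter.atTop (nhds A) → Filter.Tendsto (fun T : ℝ ↦ (16 * Real.pi ^ 2 * T ^ 2)⁻¹ * ∫ x, Real.exp (-f x / T) ∂μ) Filter.atTop (nhds A) := by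
  intro X _ μ f hf hf0 hint A hA
  set V : ℝ → ℝ := fun t ↦ (μ {x | f x < t}).toReal with hV
  have hA' : Tendsto (fun t : ℝ ↦ V t / (8 * Real.pi ^ 2 * t ^ 2)) atTop (𝓝 A) := hA
  have hint1 : Integrable (fun x ↦ Real.exp (-f x)) μ := by simpa using hint 1 one_pos
  have hfin : ∀ t, μ {x | f x < t} < ∞ := sublevelLimit_measure_lt_top hint1
  have hVnn : ∀ t, 0 ≤ V t := fun t ↦ ENNReal.toReal_nonneg
  have hVmono : Monotone V := fun s t hst ↦
    ENNReal.toReal_mono (hfin t).ne (measure_mono fun x (hx : f x < s) ↦ hx.trans_le hst)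
  have hVmeas : Measurable V := hVmono.measurable
  -- (1) layer cake, with the substitution `t = T s` built in
  have hLC : ∀ T : ℝ, 0 < T →
      ∫ x, Real.exp (-f x / T) ∂μ = ∫ s in Ioi (0 : ℝ), Real.exp (-s) * V (T * s) := by
    intro T hT
    have h := sublevelLimit_integral_exp_neg (μ := μ) (g := fun x ↦ f x / T) (hf.div_const T)
      (fun x ↦ div_nonneg (hf0 x) hT.le) (by simpa only [neg_div] using hint T hT)
    simp only [neg_div] at h ⊢
    rw [h]
    refine setIntegral_congr_fun measurableSet_Ioi fun t _ ↦ ?_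
    have hset : {x | f x / T < t} = {x | f x < T * t} := by
      ext x
      simp only [Set.mem_setOf_eq, div_lt_iff₀ hT, mul_comm]
    show Real.exp (-t) * (μ {x | f x / T < t}).toReal = Real.exp (-t) * (μ {x | f x < T * t}).toReal
    rw [hset]
  -- (2) a quadratic bound `V t ≤ C₀ + C₁ · 8π² t²`
  obtain ⟨t₀, ht₀⟩ := ((hA'.eventually_lt_const (by linarith [le_abs_self A] : A < |A| + 1)).and
    (eventually_gt_atTop 0)).exists_forall_of_atTop
  have hVbd : ∀ t, V t ≤ V t₀ + (|A| + 1) * (8 * Real.pi ^ 2 * t ^ 2) := by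
    intro t
    rcases le_total t t₀ with h | h
    · exact (hVmono h).trans (le_add_of_nonneg_right (by positivity))
    · have h8 : 0 < 8 * Real.pi ^ 2 * t ^ 2 := by have := (ht₀ t h).2; positivity
      have hlt := (div_lt_iff₀ h8).1 (ht₀ t h).1
      linarith [hVnn t₀]
  -- (3) dominated convergence on `(0, ∞)`
  have key : Tendsto (fun T : ℝ ↦ ∫ s in Ioi (0 : ℝ),
      (16 * Real.pi ^ 2 * T ^ 2)⁻¹ * (Real.exp (-s) * V (T * s))) atTop
      (𝓝 (∫ s in Ioi (0 : ℝ), Real.exp (-s) * s ^ 2 * (A / 2))) := by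
    refine tendsto_integral_filter_of_dominated_convergence
      (fun s ↦ Real.exp (-s) * (V t₀ + (|A| + 1) * s ^ 2)) ?_ ?_ ?_ ?_
    · refine Eventually.of_forall fun T ↦ Measurable.aestronglyMeasurable ?_
      exact ((Real.continuous_exp.measurable.comp measurable_neg).mul
        (hVmeas.comp (measurable_const_mul T))).const_mul _
    · filter_upwards [eventually_ge_atTop (1 : ℝ)] with T hT
      filter_upwards [ae_restrict_mem measurableSet_Ioi] with s hs
      rw [Real.norm_of_nonneg (by positivity)]
      have hπ : 1 ≤ Real.pi ^ 2 := by nlinarith [Real.pi_gt_three]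
      have hD : 1 ≤ 16 * Real.pi ^ 2 * T ^ 2 := by nlinarith
      have hVT : V (T * s) ≤ 16 * Real.pi ^ 2 * T ^ 2 * (V t₀ + (|A| + 1) * s ^ 2) := by
        refine (hVbd (T * s)).trans ?_
        nlinarith [mul_nonneg (hVnn t₀) (sub_nonneg.2 hD),
          mul_nonneg (mul_nonneg (by positivity : (0 : ℝ) ≤ |A| + 1) (sq_nonneg T))
            (mul_nonneg (sq_nonneg Real.pi) (sq_nonneg s))]
      rw [inv_mul_le_iff₀ (by positivity)]
      calc Real.exp (-s) * V (T * s)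
          ≤ Real.exp (-s) * (16 * Real.pi ^ 2 * T ^ 2 * (V t₀ + (|A| + 1) * s ^ 2)) :=
            mul_le_mul_of_nonneg_left hVT (Real.exp_pos _).le
        _ = _ := by ring
    · have hI1 : IntegrableOn (fun s : ℝ ↦ Real.exp (-s)) (Ioi 0) := integrableOn_exp_neg_Ioi 0
      have hI2 : IntegrableOn (fun s : ℝ ↦ Real.exp (-s) * s ^ 2) (Ioi 0) := by
        refine (Real.GammaIntegral_convergent (by norm_num : (0 : ℝ) < 3)).congr_fun
          (fun s _ ↦ ?_) measurableSet_Ioi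
        simp only [show (3 : ℝ) - 1 = 2 by norm_num, Real.rpow_two]
      have hI3 : IntegrableOn
          (fun s : ℝ ↦ V t₀ * Real.exp (-s) + (|A| + 1) * (Real.exp (-s) * s ^ 2)) (Ioi 0) :=
        (hI1.const_mul (V t₀)).add (hI2.const_mul (|A| + 1))
      exact hI3.congr_fun (fun s _ ↦ by ring) measurableSet_Ioi
    · filter_upwards [ae_restrict_mem measurableSet_Ioi] with s hs
      have hs' : (0 : ℝ) < s := hs
      have h1 : Tendsto (fun T : ℝ ↦ V (T * s) / (8 * Real.pi ^ 2 * (T * s) ^ 2)) atTop (𝓝 A) :=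
        hA'.comp (tendsto_id.atTop_mul_const hs')
      have h2 := h1.mul_const (Real.exp (-s) * s ^ 2 / 2)
      rw [show Real.exp (-s) * s ^ 2 * (A / 2) = A * (Real.exp (-s) * s ^ 2 / 2) by ring]
      refine h2.congr' ?_
      filter_upwards [eventually_gt_atTop (0 : ℝ)] with T hT
      field_simp
      ring
  -- (4) the limit integral is `A`, and the two sides agree for `T > 0`
  rw [integral_mul_const, sublevelLimit_integral_exp_neg_mul_sq,
    show 2 * (A / 2) = A by ring] at key
  refine key.congr' ?_
  filter_upwards [eventually_gt_atTop (0 : ℝ)] with T hT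
  rw [integral_const_mul, hLC T hT]

end Summit.SmoothPoincare4.SmoothPoincare4.Theorems.ConicalGapSketch
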